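import Summits.QuantumFields.YangMills.Theorems.UnitScaleTiltProp7ConjResolventOfGreenBlockRows
import HarnessLib

/-!
# Route `UnitScaleTilt`, crux K1 «MinimiserStabilityRegPr» (stmt-QuantumFields-19200), EX rows `h137kπ` ∕ `h137kΔ` ∕ `hCk` — K-STOREY, FILE (K2-R):
# **THE L-ONLY WINDOW (R_L) OF px10's `hKinv` FAMILY KNIT IS INHABITABLE ON THE S-ROAD** — with `δ₃ L := 2k(μ L)` from ✓`Prop7ConjResolventOfGreenBlockRows`, every term of
# `6·BG·δ̂ + 6·δ₃·(6 + δ̂) + δ̂·(BG + δ₃)·(6 + δ̂)` (`δ̂ = √216·(e^{4μ} − 1)`) vanishes as the slope `μ → 0⁺`, so (R_L) is a CHOICE OF THE SLOPE, not a constraint on the letters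

Cell `ym3-torus` (HUMAN RULING D-0037; rung R3 = SU(2) YM₃ on T³ — NOT d = 4, NOT infinite volume, NOT a mass gap, NOT Clay).  Width seat `ym3-torus-px12` (gen 17), CLAIM 2026-08-30
12:39Z (first refusal px10 g14 ∕ px16 g14).  THEOREMS ONLY (0 `def`, 0 `sorry`, default heartbeats); `--supports stmt-QuantumFields-19200 --as helper`; count-neutral.  Pure real analysis.

THE TEXTS.  px10 ✓`Prop7KinvRowOfConjLetters.kinvRow_family_of_coercive_of_conjResolvent` displays, besides the letters (m₀) `m₀ L > 0`, (B_G) `BG L ≥ 0`, (δ₃) `δ₃ L ≥ 0` at slope `μ L ≥ 0`,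
ONE L-only window `hR : ∀ L, 1 < L → 6 * BG L * (Real.sqrt 216 * (Real.exp (μ L * (3 + 1)) - 1)) + 6 * δ₃ L * (6 + Real.sqrt 216 * (Real.exp (μ L * (3 + 1)) - 1))
+ (Real.sqrt 216 * (Real.exp (μ L * (3 + 1)) - 1)) * (BG L + δ₃ L) * (6 + Real.sqrt 216 * (Real.exp (μ L * (3 + 1)) - 1)) ≤ m₀ L / 2`.  On the S-road (δ₃ from the Green block
rows `hGblk` with L-only `CG L ≥ 0` at rate `δ L > 0`, ✓`conj_resolvent_of_greenBlockSup` ∕ its family edition) `δ₃ L = 2·((CG L·(μ L·(2∕(δ L − μ L) + 6)·e^{6μ L}))·(2(1 + 2∕(δ L − μ L)))³)`,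
a continuous function of `μ L` on `(−∞, δ L)` vanishing at `μ L = 0`, as is `δ̂`.  Hence:

WHAT IS PROVED (ns `Summit.QuantumFields.YangMills.Theorems.Prop7KinvWindowRLInhabited`).
* ★ `exists_slope_RL` — for `0 < m₀`, `0 < δ` (any `BG`, `CG`) there is a slope `μ` with `0 < μ`, `μ < δ` and the member-free window text above (at `δ₃ := 2k(μ)`) — continuity at `0`
  of a function vanishing there (`ContinuousAt` algebra, `Filter.Tendsto.eventually_lt_const`, `Ioo 0 δ ∈ 𝓝[>] 0`).
* ★★ `exists_slope_family_RL` — for L-only letters `m₀ BG CG δ : ℕ → ℝ` (`0 < m₀ L`, `0 ≤ CG L`, `0 < δ L` under `1 < L`): `∃ μ : ℕ → ℝ` with, for every `1 < L`, `0 < μ L`, `μ L < δ L`, `0 ≤ δ₃ L` and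
  px10's `hR` ROW TEXT at `δ₃ L := 2·((CG L·(μ L·(2∕(δ L − μ L) + 6)·e^{6μ L}))·(2(1 + 2∕(δ L − μ L)))³)` (pointwise choice).
EFFECT (by name): ✓p768818 §3 ∘ {(K1) `m₀`, (γ) `BG` ✓`norm_GT_le_of_coercive`, px16 (Gb)-FAMILY `CG`∕`δG` ✓p772637 through ✓`conj_resolvent_family_DeltaEtaSlot_of_greenBlockSup`} now has NO displayed
numeric window left at the η-slot: `hμ`, `hδ₃`, `hres`, `hR` are all served from `(m₀, BG, CG, δG)` by this file and the S-road.
HONEST SCOPE.  Elementary real analysis; nothing of the letters' suppliers, `hKinv`, `h133`, `norm_G`, the EX rows, `hThm2S`, EX or the crux is proved; nothing continuum ∕ OS ∕ mass-gap ∕ Clay.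

References: T. Bałaban, CMP **99** (1985) 389–434 [Balaban1985BackgroundPropagators] ((3.132) p.422, Thm 3.1 (3.46) p.398); CMP **96** (1984) 223–250 [Balaban1984PropagatorsII] (§2).
-/

set_option autoImplicit false

noncomputable section

open Filter Topology

namespace Summit.QuantumFields.YangMills.Theorems.Prop7KinvWindowRLInhabited

/-- ★ **THE WINDOW (R) IS A CHOICE OF THE SLOPE**: for `0 < m₀`, `0 < δ` and ANY reals `BG`, `CG` there is `μ ∈ (0, δ)` with
`6·BG·δ̂ + 6·δ₃·(6 + δ̂) + δ̂·(BG + δ₃)·(6 + δ̂) ≤ m₀∕2`, `δ̂ = √216·(e^{μ(3+1)} − 1)`, `δ₃ = 2·((CG·(μ·(2∕(δ−μ) + 6)·e^{6μ}))·(2(1 + 2∕(δ−μ)))³)` — the left side is continuous at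
`μ = 0` and vanishes there. [cite: Balaban1985BackgroundPropagators, (3.132) p.422; Balaban1984PropagatorsII, §2] -/
theorem exists_slope_RL {m₀ : ℝ} (BG CG : ℝ) {δ : ℝ} (hm₀ : 0 < m₀) (hδ : 0 < δ) :
    ∃ μ : ℝ, 0 < μ ∧ μ < δ ∧
      6 * BG * (Real.sqrt 216 * (Real.exp (μ * (3 + 1)) - 1))
          + 6 * (2 * ((CG * (μ * (2 / (δ - μ) + 6) * Real.exp (6 * μ))) * (2 * (1 + 2 / (δ - μ))) ^ 3))
              * (6 + Real.sqrt 216 * (Real.exp (μ * (3 + 1)) - 1))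
          + (Real.sqrt 216 * (Real.exp (μ * (3 + 1)) - 1))
              * (BG + 2 * ((CG * (μ * (2 / (δ - μ) + 6) * Real.exp (6 * μ))) * (2 * (1 + 2 / (δ - μ))) ^ 3))
              * (6 + Real.sqrt 216 * (Real.exp (μ * (3 + 1)) - 1))
        ≤ m₀ / 2 := by
  -- the left side as a function of the slope
  let f : ℝ → ℝ := fun μ =>
    6 * BG * (Real.sqrt 216 * (Real.exp (μ * (3 + 1)) - 1))
      + 6 * (2 * ((CG * (μ * (2 / (δ - μ) + 6) * Real.exp (6 * μ))) * (2 * (1 + 2 / (δ - μ))) ^ 3))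
          * (6 + Real.sqrt 216 * (Real.exp (μ * (3 + 1)) - 1))
      + (Real.sqrt 216 * (Real.exp (μ * (3 + 1)) - 1))
          * (BG + 2 * ((CG * (μ * (2 / (δ - μ) + 6) * Real.exp (6 * μ))) * (2 * (1 + 2 / (δ - μ))) ^ 3))
          * (6 + Real.sqrt 216 * (Real.exp (μ * (3 + 1)) - 1))
  have hδ0 : δ - 0 ≠ 0 := by rw [sub_zero]; exact hδ.ne'
  have hdiv : ContinuousAt (fun μ : ℝ => 2 / (δ - μ)) 0 :=
    ContinuousAt.div continuousAt_const (continuousAt_const.sub continuousAt_id) hδ0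
  have hf : ContinuousAt f 0 := by
    have he4 : ContinuousAt (fun μ : ℝ => Real.exp (μ * (3 + 1))) 0 := (continuousAt_id.mul continuousAt_const).rexp
    have he6 : ContinuousAt (fun μ : ℝ => Real.exp (6 * μ)) 0 := (continuousAt_const.mul continuousAt_id).rexp
    have hhat : ContinuousAt (fun μ : ℝ => Real.sqrt 216 * (Real.exp (μ * (3 + 1)) - 1)) 0 := continuousAt_const.mul (he4.sub continuousAt_const)
    have hD : ContinuousAt (fun μ : ℝ => 2 * ((CG * (μ * (2 / (δ - μ) + 6) * Real.exp (6 * μ))) * (2 * (1 + 2 / (δ - μ))) ^ 3)) 0 :=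
      continuousAt_const.mul ((continuousAt_const.mul ((continuousAt_id.mul (hdiv.add continuousAt_const)).mul he6)).mul
        ((continuousAt_const.mul (continuousAt_const.add hdiv)).pow 3))
    exact (((continuousAt_const.mul continuousAt_const).mul hhat).add ((continuousAt_const.mul hD).mul (continuousAt_const.add hhat))).add
      ((hhat.mul (continuousAt_const.add hD)).mul (continuousAt_const.add hhat))
  have hf0 : f 0 = 0 := by simp [f]
  -- eventually below `m₀ / 2` near `0`, and in `(0, δ)` to the right of `0`
  have hlt : ∀ᶠ μ in 𝓝 (0 : ℝ), f μ < m₀ / 2 := by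
    have h : Tendsto f (𝓝 0) (𝓝 (f 0)) := hf
    rw [hf0] at h
    exact h.eventually (Iio_mem_nhds (by positivity))
  have hin : ∀ᶠ μ in 𝓝[>] (0 : ℝ), 0 < μ ∧ μ < δ := by
    filter_upwards [Ioo_mem_nhdsGT hδ] with μ hμ using hμ
  obtain ⟨μ, ⟨hμ0, hμδ⟩, hμf⟩ := (hin.and (hlt.filter_mono nhdsWithin_le_nhds)).exists
  exact ⟨μ, hμ0, hμδ, hμf.le⟩

/-- ★★ **THE (R_L) WINDOW OF px10's `hKinv` FAMILY KNIT IS INHABITABLE, L BY L**: for L-only letters `m₀ BG CG δ : ℕ → ℝ` (`0 < m₀ L`, `0 ≤ CG L`, `0 < δ L` under `1 < L`)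
there is an L-only slope `μ : ℕ → ℝ` with `0 < μ L < δ L`, `0 ≤ δ₃ L` and ✓`kinvRow_family_of_coercive_of_conjResolvent`'s `hR` ROW TEXT at
`δ₃ L := 2·((CG L·(μ L·(2∕(δ L − μ L) + 6)·e^{6μ L}))·(2(1 + 2∕(δ L − μ L)))³)` (the S-road's constant, ✓`conj_resolvent_family_DeltaEtaSlot_of_greenBlockSup`).
[cite: Balaban1985BackgroundPropagators, (3.132) p.422; Balaban1984PropagatorsII, §2] -/
theorem exists_slope_family_RL (m₀ BG CG δ : ℕ → ℝ) (hm₀ : ∀ L : ℕ, 1 < L → 0 < m₀ L) (hCG : ∀ L : ℕ, 1 < L → 0 ≤ CG L) (hδ : ∀ L : ℕ, 1 < L → 0 < δ L) :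
    ∃ μ : ℕ → ℝ, (∀ L : ℕ, 1 < L → 0 < μ L) ∧ (∀ L : ℕ, 1 < L → μ L < δ L) ∧
      (∀ L : ℕ, 1 < L → 0 ≤ 2 * ((CG L * (μ L * (2 / (δ L - μ L) + 6) * Real.exp (6 * μ L))) * (2 * (1 + 2 / (δ L - μ L))) ^ 3)) ∧
      ∀ L : ℕ, 1 < L →
        6 * BG L * (Real.sqrt 216 * (Real.exp (μ L * (3 + 1)) - 1))
            + 6 * (2 * ((CG L * (μ L * (2 / (δ L - μ L) + 6) * Real.exp (6 * μ L))) * (2 * (1 + 2 / (δ L - μ L))) ^ 3))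
                * (6 + Real.sqrt 216 * (Real.exp (μ L * (3 + 1)) - 1))
            + (Real.sqrt 216 * (Real.exp (μ L * (3 + 1)) - 1))
                * (BG L + 2 * ((CG L * (μ L * (2 / (δ L - μ L) + 6) * Real.exp (6 * μ L))) * (2 * (1 + 2 / (δ L - μ L))) ^ 3))
                * (6 + Real.sqrt 216 * (Real.exp (μ L * (3 + 1)) - 1))
          ≤ m₀ L / 2 := by
  classical
  have hmem : ∀ L : ℕ, 1 < L → ∃ μ : ℝ, 0 < μ ∧ μ < δ L ∧
      6 * BG L * (Real.sqrt 216 * (Real.exp (μ * (3 + 1)) - 1))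
          + 6 * (2 * ((CG L * (μ * (2 / (δ L - μ) + 6) * Real.exp (6 * μ))) * (2 * (1 + 2 / (δ L - μ))) ^ 3))
              * (6 + Real.sqrt 216 * (Real.exp (μ * (3 + 1)) - 1))
          + (Real.sqrt 216 * (Real.exp (μ * (3 + 1)) - 1))
              * (BG L + 2 * ((CG L * (μ * (2 / (δ L - μ) + 6) * Real.exp (6 * μ))) * (2 * (1 + 2 / (δ L - μ))) ^ 3))
              * (6 + Real.sqrt 216 * (Real.exp (μ * (3 + 1)) - 1))
        ≤ m₀ L / 2 := fun L hL => exists_slope_RL (BG L) (CG L) (hm₀ L hL) (hδ L hL)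
  refine ⟨fun L => if hL : 1 < L then Classical.choose (hmem L hL) else 0, fun L hL => ?_, fun L hL => ?_, fun L hL => ?_, fun L hL => ?_⟩
  · simp only [dif_pos hL]; exact (Classical.choose_spec (hmem L hL)).1
  · simp only [dif_pos hL]; exact (Classical.choose_spec (hmem L hL)).2.1
  · simp only [dif_pos hL]
    have h1 := (Classical.choose_spec (hmem L hL)).1
    have h2 := (Classical.choose_spec (hmem L hL)).2.1
    have h3 : 0 < δ L - Classical.choose (hmem L hL) := sub_pos.2 h2
    have := hCG L hL
    positivity
  · simp only [dif_pos hL]; exact (Classical.choose_spec (hmem L hL)).2.2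

end Summit.QuantumFields.YangMills.Theorems.Prop7KinvWindowRLInhabited

end
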